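import Literature.FieldTheory.FunctionField.RationalAdditiveDecompositions
import HarnessLib

/-!
# The affine group `AGL(1, 𝔽_q) = {u ↦ au + b}` is the fixing group of `P_q = (x^q − x)^{q−1}`: over a field
# `K ⊇ 𝔽_q`, `G(P_q)` consists exactly of the `q(q−1)` affine substitutions with coefficients in `𝔽_q`,
# `|G(P_q)| = deg P_q`, `K(u)/K(P_q)` is Galois and `Fix(G(P_q)) = K(P_q)` (Gutierrez–Sevilla 2006, Def. 15, Thm 17)

Topic `Literature/FieldTheory/FunctionField`; namespace `Literature.FieldTheory.FunctionField`.  Lane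
`lit-hodgefound` (Track 2 foundations library), seat p01 gen 28, row g28-#11 — first half of the programme «GS2006
Theorem 24 / Corollary 25 (only if): for `q = p` prime all complete decompositions of `P_q` have the same length»;
this file identifies the group, the sequel does the subgroup-chain count.  Sequel BY IMPORT of g28-#6
`RationalAdditiveDecompositions` (`ratFunc_algEquiv_apply_algebraMap`, `mem_rootSet_X_pow_sub_X_iff`), g26-#3/#4
`RationalFixingGroup(Components)` (`mem_fixingSubgroup_adjoin_iff`, `exists_algEquiv_apply_X_eq`,
`card_fixingSubgroup_adjoin_le`, `card_fixingSubgroup_adjoin_eq_iff_isGalois`, `fixedField_fixingSubgroup_adjoin_of_card_eq`,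
`finite_fixingSubgroup_adjoin`), g26-#2 (`algebraMap_comp_eq_aeval`, `max_natDegree_algebraMap`) and Mathlib
(`add_pow_char_pow`, `FiniteField.X_pow_card_sub_X_natDegree_eq`, `Function.Injective.bijective_of_nat_card_le`) —
REUSED, nothing restated.  THEOREMS ONLY (no definition, no named fact, no instance, no notation; D-0014/D-0026,
net Literature debt 0).

## Source, VERBATIM (J. Gutierrez, D. Sevilla, *On Ritt's decomposition theorem in the case of finite fields*,
## Finite Fields Appl. 12 (2006) [GutierrezSevilla2006], held `paper:arxiv-0803.3976`, §3 p0006)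

«In this section, `𝕂 = 𝔽_q` where `q = p^m` and `p = char 𝔽_q` […] Definition 15. For any `𝕂`,
`Γ₀ = Γ ∩ 𝕂[x] = {ax + b : a ∈ 𝕂^*, b ∈ 𝕂}`. […] The interest of `Γ` and `Γ₀` in the case of finite fields lies in
the fact that both groups provide non-trivial fixed fields. Theorem 17. The fixed field for `Γ₀` is generated by
`(x^q − x)^{q−1}`. Proof. According to Theorem (gen-fixed-field) any non-constant coefficient of
`Q(T) = ∏_{u∈Γ₀}(T − u)` generates the field. But the constant term of `Q` is precisely `∏_{u∈Γ₀} u = (x^q − x)^{q−1}`. □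
From now on, we will denote `P_q = (x^q − x)^{q−1}`.»; proof of Thm 20 (ii): «`|G(x^q − x)| = q = deg x^q − x`, by
Theorem (props-fix) there is a bijection between the decompositions […] and the subgroups of its fixing group»;
before Def. 22: «As there is a bijection between the subgroups of `Γ₀` and the components of `(x^q − x)^{q−1}` on the
right, we will study those subgroups».

## What is formalised (`K` a field of characteristic `p`, `q = p^m`, `m ≥ 1`, HYPOTHESIS `𝔽_q ⊆ K` spelled as
## «`x^q − x` has `q` roots in `K`»; `Γ = RatFunc K ≃ₐ[K] RatFunc K`, `G(f) = (K(f)).fixingSubgroup`, `u = RatFunc.X`)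

* §1 `mem_fixingSubgroup_adjoin_of_comp_eq` (`F ∘ ℓ = F`, `σ(u) = ℓ(u)` ⟹ `σ ∈ G(F)`), `exists_algEquiv_apply_X_eq_affine`
  (`u ↦ au + b`, `a ≠ 0`, is in `Γ`), `algebraMap_affine_eq_iff` (the parameters `a, b` are determined).
* §2 `P_comp_affine` (`P_q ∘ (au + b) = P_q` for `a ∈ 𝔽_q^*`, `b ∈ 𝔽_q`: `(ax + b)^q − (ax + b) = a(x^q − x)`,
  `a^{q−1} = 1`), `natDegree_X_pow_sub_X_pow_pred` (`deg P_q = q(q−1)`), **`card_fixingSubgroup_adjoin_P`** — THEOREM 17, group form: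
  `|G(P_q)| = q(q−1)` AND every `σ ∈ G(P_q)` is `u ↦ au + b` with `a ∈ 𝔽_q^*`, `b ∈ 𝔽_q` (the `q(q−1)` substitutions
  inject into `G(P_q)`, whose order is `≤ deg P_q = q(q−1)` by GS2008 Thm 7 (i)), **`isGalois_adjoin_P`**
  (`K(u)/K(P_q)` Galois), **`fixedField_fixingSubgroup_adjoin_P`** (THEOREM 17: `Fix(Γ₀) = K(P_q)`).

## Honest deviations

GS work over `𝕂 = 𝔽_q` and prove Theorem 17 through the product `∏_{u∈Γ₀} u`; here `K` is any field of
characteristic `p` containing the roots of `x^q − x`, `Γ₀` is realised as the set of `σ ∈ Γ` with `σ(u) = au + b`,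
`a^q = a ≠ 0`, `b^q = b`, and the identification `G(P_q) = Γ₀` is obtained by counting (`q(q−1)` distinct elements
inside a group of order `≤ deg P_q`).  Theorem 18 (`Fix(Γ)`, `h_q`) is not formalised.

## References
* [GutierrezSevilla2006] J. Gutierrez, D. Sevilla, *On Ritt's decomposition theorem in the case of finite fields*,
  Finite Fields Appl. 12 (2006) 403–412, §3 Definition 15, Theorem 17, proof of Theorem 20 (ii).
* [GutierrezSevilla2008] J. Gutierrez, D. Sevilla, J. Algebra 303 (2006), §3 Thms 6–7 (tree g26-#3).
-/

open Polynomial IntermediateField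

namespace Literature.FieldTheory.FunctionField

variable {K : Type*} [Field K]

/-! ### §1. Affine substitutions `u ↦ a u + b` -/

/-- If `F ∘ ℓ = F` and `σ(u) = ℓ(u)` then `σ ∈ G(F)`. [cite: GutierrezSevilla2008, §3 Def. 4 (G(f) = {u : f ∘ u = f})] -/
theorem mem_fixingSubgroup_adjoin_of_comp_eq {F ℓ : K[X]} (h : F.comp ℓ = F)
    {σ : RatFunc K ≃ₐ[K] RatFunc K} (hσ : σ RatFunc.X = algebraMap K[X] (RatFunc K) ℓ) :
    σ ∈ (IntermediateField.adjoin K ({algebraMap K[X] (RatFunc K) F} : Set (RatFunc K))).fixingSubgroup := by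
  rw [mem_fixingSubgroup_adjoin_iff, ratFunc_algEquiv_apply_algebraMap, hσ, ← algebraMap_comp_eq_aeval, h]

/-- The affine substitution `u ↦ au + b` (`a ≠ 0`) is an element of `Γ`. [cite: GutierrezSevilla2006, §3 Def. 15 (Γ₀ = {ax + b})] -/
theorem exists_algEquiv_apply_X_eq_affine {a : K} (ha : a ≠ 0) (b : K) :
    ∃ σ : RatFunc K ≃ₐ[K] RatFunc K, σ RatFunc.X = algebraMap K[X] (RatFunc K) (C a * X + C b) := by
  refine exists_algEquiv_apply_X_eq _ ?_
  rw [max_natDegree_algebraMap, natDegree_add_C, natDegree_C_mul ha, natDegree_X]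

/-- The parameters `a, b` of an affine substitution are determined by it. [cite: GutierrezSevilla2006, §3 Def. 15] -/
theorem algebraMap_affine_eq_iff {a b a' b' : K} :
    algebraMap K[X] (RatFunc K) (C a * X + C b) = algebraMap K[X] (RatFunc K) (C a' * X + C b') ↔
      a = a' ∧ b = b' := by
  constructor
  · intro h
    have h' := IsFractionRing.injective K[X] (RatFunc K) h
    have h1 := congrArg (fun F : K[X] => F.coeff 1) h'
    have h0 := congrArg (fun F : K[X] => F.coeff 0) h'
    simp only [coeff_add, coeff_C_mul, coeff_X_one, coeff_X_zero, coeff_C, mul_one, mul_zero,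
      if_neg one_ne_zero, add_zero, zero_add] at h1 h0
    exact ⟨h1, h0⟩
  · rintro ⟨rfl, rfl⟩
    rfl

section Affine

variable (p : ℕ) [hp : Fact p.Prime] [CharP K p]

/-! ### §2. Theorem 17: `G(P_q) = Γ₀` -/

/-- **`P_q ∘ (au + b) = P_q`** for `P_q = (x^q − x)^{q−1}`, `a ∈ 𝔽_q^*`, `b ∈ 𝔽_q` (`(ax+b)^q − (ax+b) = a(x^q − x)` and
`a^{q−1} = 1`). [cite: GutierrezSevilla2006, §3 Thm 17 (P_q is fixed by Γ₀)] -/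
theorem P_comp_affine {m : ℕ} {a b : K} (ha : a ^ p ^ m = a) (ha0 : a ≠ 0) (hb : b ^ p ^ m = b) :
    (((X : K[X]) ^ p ^ m - X) ^ (p ^ m - 1)).comp (C a * X + C b) = ((X : K[X]) ^ p ^ m - X) ^ (p ^ m - 1) := by
  have hq : 1 ≤ p ^ m := Nat.one_le_pow _ _ hp.out.pos
  have haq : a ^ (p ^ m - 1) = 1 := by
    have h : a ^ (p ^ m - 1) * a = 1 * a := by rw [← pow_succ, Nat.sub_add_cancel hq, ha, one_mul]
    exact mul_right_cancel₀ ha0 h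
  have hℓ : (C a * X + C b : K[X]) ^ p ^ m - (C a * X + C b) = C a * (X ^ p ^ m - X) := by
    rw [add_pow_char_pow, mul_pow, ← C_pow, ← C_pow, ha, hb]
    ring
  rw [pow_comp, sub_comp, X_pow_comp, X_comp, hℓ, mul_pow, ← C_pow, haq, C_1, one_mul]

omit [CharP K p] in
/-- `deg P_q = q(q − 1) = |Γ₀|`. [cite: GutierrezSevilla2006, §3 Thm 17] -/
theorem natDegree_X_pow_sub_X_pow_pred {m : ℕ} (hm : 1 ≤ m) :
    ((((X : K[X]) ^ p ^ m - X) ^ (p ^ m - 1)).natDegree) = p ^ m * (p ^ m - 1) := by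
  have hpm : 2 ≤ p ^ m :=
    calc 2 ≤ p := hp.out.two_le
      _ = p ^ 1 := (pow_one p).symm
      _ ≤ p ^ m := Nat.pow_le_pow_right hp.out.pos hm
  rw [natDegree_pow, FiniteField.X_pow_card_sub_X_natDegree_eq K hpm, mul_comm]

/-- **THEOREM 17, fixing-group form: over a field containing `𝔽_q`, `|G(P_q)| = q(q − 1) = deg P_q`, and `G(P_q)`
consists exactly of the affine substitutions `u ↦ au + b`, `a ∈ 𝔽_q^*`, `b ∈ 𝔽_q`** (they inject into `G(P_q)`, and
`|G(P_q)| ≤ deg P_q`). [cite: GutierrezSevilla2006, §3 Def. 15, Thm 17][cite: GutierrezSevilla2008, §3 Thm 7 (i)] -/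
theorem card_fixingSubgroup_adjoin_P {m : ℕ} (hm : 1 ≤ m)
    (hroots : (((X : K[X]) ^ p ^ m - X).rootSet K).ncard = p ^ m) :
    Nat.card (IntermediateField.adjoin K
        ({algebraMap K[X] (RatFunc K) (((X : K[X]) ^ p ^ m - X) ^ (p ^ m - 1))} : Set (RatFunc K))).fixingSubgroup =
      p ^ m * (p ^ m - 1) ∧
    ∀ σ ∈ (IntermediateField.adjoin K
        ({algebraMap K[X] (RatFunc K) (((X : K[X]) ^ p ^ m - X) ^ (p ^ m - 1))} : Set (RatFunc K))).fixingSubgroup,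
      ∃ a b : K, a ^ p ^ m = a ∧ a ≠ 0 ∧ b ^ p ^ m = b ∧
        σ RatFunc.X = algebraMap K[X] (RatFunc K) (C a * X + C b) := by
  have hpm : 2 ≤ p ^ m :=
    calc 2 ≤ p := hp.out.two_le
      _ = p ^ 1 := (pow_one p).symm
      _ ≤ p ^ m := Nat.pow_le_pow_right hp.out.pos hm
  set R : Set K := ((X : K[X]) ^ p ^ m - X).rootSet K with hR
  have hRmem : ∀ w, w ∈ R ↔ w ^ p ^ m = w := fun w => mem_rootSet_X_pow_sub_X_iff p hm
  set P : K[X] := ((X : K[X]) ^ p ^ m - X) ^ (p ^ m - 1) with hP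
  have hPdeg : P.natDegree = p ^ m * (p ^ m - 1) := natDegree_X_pow_sub_X_pow_pred p hm
  have hP0 : P.natDegree ≠ 0 := by
    rw [hPdeg]
    exact Nat.mul_ne_zero (by omega) (by omega)
  have hPc := algebraMap_ne_C_of_natDegree_ne_zero hP0
  set G := (IntermediateField.adjoin K ({algebraMap K[X] (RatFunc K) P} : Set (RatFunc K))).fixingSubgroup with hG
  haveI : Finite G := finite_fixingSubgroup_adjoin hPc
  -- the injection `(a, b) ↦ σ_{a,b}`
  have hR0 : (0 : K) ∈ R := (hRmem 0).mpr (by rw [zero_pow (by omega)])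
  haveI : Finite R := ((X : K[X]) ^ p ^ m - X).rootSet_finite K
  set D := (R \ {0} : Set K) ×ˢ R with hD
  have hDcard : Nat.card D = (p ^ m - 1) * p ^ m := by
    rw [hD, Nat.card_congr (Equiv.Set.prod _ _), Nat.card_prod, Nat.card_coe_set_eq, Nat.card_coe_set_eq,
      Set.ncard_sdiff_singleton_of_mem hR0, hroots]
  choose σ hσ using fun x : D =>
    exists_algEquiv_apply_X_eq_affine (K := K) (a := x.1.1) (fun h0 => x.2.1.2 h0) x.1.2
  have hσG : ∀ x : D, σ x ∈ G := fun x =>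
    mem_fixingSubgroup_adjoin_of_comp_eq
      (P_comp_affine p ((hRmem _).mp x.2.1.1) (fun h0 => x.2.1.2 h0) ((hRmem _).mp x.2.2)) (hσ x)
  let f : D → G := fun x => ⟨σ x, hσG x⟩
  have hf : Function.Injective f := by
    intro x y h
    have h' : σ x = σ y := congrArg Subtype.val h
    have h'' := congrArg (fun τ : RatFunc K ≃ₐ[K] RatFunc K => τ RatFunc.X) h'
    simp only [hσ, algebraMap_affine_eq_iff] at h''
    exact Subtype.ext (Prod.ext h''.1 h''.2)
  have hle : Nat.card G ≤ P.natDegree := by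
    have h := card_fixingSubgroup_adjoin_le hPc
    rwa [max_natDegree_algebraMap] at h
  have hge : P.natDegree ≤ Nat.card G := by
    rw [hPdeg, mul_comm, ← hDcard]
    exact Nat.card_le_card_of_injective f hf
  have hcard : Nat.card G = p ^ m * (p ^ m - 1) := by rw [← hPdeg]; exact le_antisymm hle hge
  refine ⟨hcard, fun τ hτ => ?_⟩
  have hbij := hf.bijective_of_nat_card_le (by rw [hcard, hDcard, mul_comm])
  obtain ⟨x, hx⟩ := hbij.2 ⟨τ, hτ⟩
  refine ⟨x.1.1, x.1.2, (hRmem _).mp x.2.1.1, fun h0 => x.2.1.2 h0, (hRmem _).mp x.2.2, ?_⟩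
  have h := congrArg Subtype.val hx
  simp only [f] at h
  rw [← h, hσ]

/-- **`K(u)/K(P_q)` is Galois** (`|G(P_q)| = deg P_q`, GS2008 Thm 7 (ii)). [cite: GutierrezSevilla2006, §3 Thm 17][cite: GutierrezSevilla2008, §3 Thm 7 (ii)] -/
theorem isGalois_adjoin_P {m : ℕ} (hm : 1 ≤ m) (hroots : (((X : K[X]) ^ p ^ m - X).rootSet K).ncard = p ^ m) :
    IsGalois (IntermediateField.adjoin K
      ({algebraMap K[X] (RatFunc K) (((X : K[X]) ^ p ^ m - X) ^ (p ^ m - 1))} : Set (RatFunc K))) (RatFunc K) := by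
  have hP0 : ((((X : K[X]) ^ p ^ m - X) ^ (p ^ m - 1)).natDegree) ≠ 0 := by
    rw [natDegree_X_pow_sub_X_pow_pred p hm]
    have hpm : 2 ≤ p ^ m :=
      calc 2 ≤ p := hp.out.two_le
        _ = p ^ 1 := (pow_one p).symm
        _ ≤ p ^ m := Nat.pow_le_pow_right hp.out.pos hm
    exact Nat.mul_ne_zero (by omega) (by omega)
  refine (card_fixingSubgroup_adjoin_eq_iff_isGalois (algebraMap_ne_C_of_natDegree_ne_zero hP0)).mp ?_
  rw [(card_fixingSubgroup_adjoin_P p hm hroots).1, max_natDegree_algebraMap, natDegree_X_pow_sub_X_pow_pred p hm]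

/-- **THEOREM 17: `Fix(Γ₀) = K(P_q)`** — the field fixed by all the affine substitutions over `𝔽_q` is generated by
`P_q = (x^q − x)^{q−1}` (here `Γ₀ = G(P_q)` by `card_fixingSubgroup_adjoin_P`). [cite: GutierrezSevilla2006, §3 Thm 17] -/
theorem fixedField_fixingSubgroup_adjoin_P {m : ℕ} (hm : 1 ≤ m)
    (hroots : (((X : K[X]) ^ p ^ m - X).rootSet K).ncard = p ^ m) :
    IntermediateField.fixedField (IntermediateField.adjoin K
        ({algebraMap K[X] (RatFunc K) (((X : K[X]) ^ p ^ m - X) ^ (p ^ m - 1))} : Set (RatFunc K))).fixingSubgroup =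
      IntermediateField.adjoin K
        ({algebraMap K[X] (RatFunc K) (((X : K[X]) ^ p ^ m - X) ^ (p ^ m - 1))} : Set (RatFunc K)) := by
  have hP0 : ((((X : K[X]) ^ p ^ m - X) ^ (p ^ m - 1)).natDegree) ≠ 0 := by
    rw [natDegree_X_pow_sub_X_pow_pred p hm]
    have hpm : 2 ≤ p ^ m :=
      calc 2 ≤ p := hp.out.two_le
        _ = p ^ 1 := (pow_one p).symm
        _ ≤ p ^ m := Nat.pow_le_pow_right hp.out.pos hm
    exact Nat.mul_ne_zero (by omega) (by omega)
  refine fixedField_fixingSubgroup_adjoin_of_card_eq (algebraMap_ne_C_of_natDegree_ne_zero hP0) ?_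
  rw [(card_fixingSubgroup_adjoin_P p hm hroots).1, max_natDegree_algebraMap, natDegree_X_pow_sub_X_pow_pred p hm]

end Affine

end Literature.FieldTheory.FunctionField
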